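import Summits.QuantumFields.YangMills.Theorems.LuscherReductionTwistedTraceScalingMehlerPoincare
import HarnessLib

/-!
# (B-ST) flat Poincaré atom (B1), first brick: the explicit Gaussian form of the Mehler ground state and the completed square of `K(x,·)·hR 0`
# (lane A of S-BASE, crux `TwistedTraceScaling` stmt-QuantumFields-20203, C4-CORE, the (B-ST) pen; HANDOFF-g21 'REMAINING ANALYTIC ATOMS' (B1))

★ `hR_zero_apply` — `hR 0 x = 2^{n/4}·exp(−π Σ_k x_k²)`; ★★ `mehlerKernel_mul_hR_zero_eq` — completing the square coordinatewise:
`K_{a,b}(x,y)·hR 0 (y) = hR 0 (x) · exp(−Σ_k (a_k + b_k − π − b_k²/s_k)·x_k²)·… ` stated in the usable form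
`K(x,y) hR0(y) = 2^{n/4} exp(−Σ_k [s_k (y_k − (b_k/s_k) x_k)² + (a_k + b_k − b_k²/s_k) x_k²])`, `s_k = a_k + b_k + π` — the OU transition from `x` is Gaussian, centred at
`ρ_k x_k` (`ρ_k = b_k/s_k < 1`: CONTRACTION) with precision `s_k`; this is what makes the exit mass from a box uniformly small up to the boundary (the (B1) estimate proper).
HONEST FRAMING: bookkeeping for a stub of a child of the CONDITIONAL route R2b1; (B-ST) OPEN; C4-CORE OPEN; not infinite volume, not a gap, not Clay.
-/

set_option autoImplicit false

noncomputable section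

open MeasureTheory MvPolynomial Complex
open scoped Real

namespace Summit.QuantumFields.YangMills.Theorems.FemtoTransferGap.Mehler

open Literature.Analysis.SegalBargmann

variable {σ : Type*} [Fintype σ] [DecidableEq σ]

/-- ★ **The ground state is the Gaussian** `hR 0 x = 2^{n/4} e^{−π|x|²}`. [cite: Folland1989, §1.7 (vii)] -/
theorem hR_zero_apply (x : σ → ℝ) : hR 0 x = vacCoef σ * Real.exp (-(π * ∑ k, x k ^ 2)) := by
  unfold hR hermiteFun
  rw [herm_zero, vac, eval_C, gauss]
  have e : (-(π : ℂ) * ∑ k, ((x k : ℝ) : ℂ) ^ 2) = ((-(π * ∑ k, x k ^ 2) : ℝ) : ℂ) := by push_cast; ring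
  rw [e, ← Complex.ofReal_exp, ← Complex.ofReal_mul, Complex.ofReal_re]

omit [DecidableEq σ] in
/-- ★★ **Completing the square**: `K_{a,b}(x,y)·hR 0 (y) = 2^{n/4}·exp(−Σ_k [s_k (y_k − (b_k/s_k)x_k)² + (a_k + b_k − b_k²/s_k) x_k²])`, `s_k = a_k + b_k + π > 0`. [folklore] -/
theorem mehlerKernel_mul_hR_zero_eq [DecidableEq σ] {a b : σ → ℝ} (hs : ∀ k, 0 < a k + b k + π) (x y : σ → ℝ) :
    mehlerKernel a b x y * hR 0 y =
      vacCoef σ * Real.exp (-∑ k, ((a k + b k + π) * (y k - b k / (a k + b k + π) * x k) ^ 2 + (a k + b k - b k ^ 2 / (a k + b k + π)) * x k ^ 2)) := by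
  rw [hR_zero_apply, mehlerKernel]
  rw [mul_left_comm, ← Real.exp_add]
  congr 1
  congr 1
  rw [Finset.mul_sum, ← neg_add, ← Finset.sum_add_distrib, neg_inj]
  refine Finset.sum_congr rfl fun k _ => ?_
  have hsk := (hs k).ne'
  field_simp
  ring

end Summit.QuantumFields.YangMills.Theorems.FemtoTransferGap.Mehler

end
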